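import Summits.QuantumFields.YangMills.Theorems.AlphaInputsT3ACMinimiserPin
import Literature.MathematicalPhysics.QuantumFieldTheory.Balaban1983to89.T3Thm1CarrierNative
import HarnessLib

/-!
# Route `UnitScaleTilt`, crux K1 «MinimiserStabilityRegPr» (stmt-QuantumFields-19200) ∕ DECIDING crux 20520 through T8 — **THE COMPACTNESS HALF OF
# [Balaban1985Variational] PROP. 7's EXISTENCE CLAUSE AT THE T³ CARRIER: the Wilson action ATTAINS its minimum on print's CLOSED regular fibre
# `(6̄)(e) = {|U(∂p) − 1| ≤ eL^{−2k}} ∩ {‖D*∂U‖ ≤ eL^{−3k}} ∩ 𝔅_k(V)`, and the existence half of `Prop7From14NativeAt` (route-R's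
# `stub_existenceMinimalOrbit` text) is RE-POINTED onto ONE displayed ∀-sentence «closed-fibre minimisers are interior»**

Cell `ym3-torus` (HUMAN RULING D-0037, YM ladder rung R3), width seat `ym-ust-20520-w4` (g0), the OWNER's optional named item of 2026-08-27T23:19Z
(«the COMPACTNESS HALF of `Prop7From14At` clause 2»).  THEOREMS ONLY (0 `def`, 0 `sorry`, standard axioms); nothing imported is modified.

WHERE THIS SITS.  V3 = `T3Thm1CarrierNative.Prop7From14At` (Prop. 7 from a background (14)) has two clauses; the EXISTENCE clause reads, natively,
«`ε₁ ≤ a′₁ ⇒ ∃ U ∈ regFibrePr (O₁L³B₃ε₁) V` minimising the Wilson action (5) over that space» given a (7)-datum `V` and a background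
`U₀ ∈ 𝔘_k(L³B₃ε₁) ∩ 𝔅_k(V)` (`Prop7From14NativeAt`, second conjunct; = the text of route-R's `stub_existenceMinimalOrbit`, OWNER RULING g24-№2 §(c)).
Print reaches it through the chart (Props 4–6, the contraction (111)) and the second-order argument (141)–(143) p. 299.  The DIRECT METHOD gives half
of it for free — this file — and isolates the other half as one sentence:
* §1 the closed regular fibre `(6̄)(e)` (the `≤`-companions of both clauses of (2) ∩ the descent fibre, the inline set of
  `AlphaInputsT3ACMinimiserPin.isClosed_closedRegFibre`) sandwiches print's open space: `(6)(e) ⊆ (6̄)(e) ⊆ (6)(e′)` for `e < e′`, and CONTAINS THE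
  BACKGROUND `U₀` of (14) as soon as `L³B₃ε₁ ≤ e` — so it is non-empty exactly where Prop. 7 is stated;
* §2 ★ `exists_isMinOn_closedRegFibre`: for `0 < e ≤ r` with `2r` admissible in the sense of [Balaban1985Averaging] (53) (`C₀(3)·2r ≤ ⅓`,
  `4r ≤ 2δ₂/(7L)²`; such an `r > 0` exists for every `L`, `exists_admissibleRadius`) and every datum `V` with `(6̄)(e) ∩ 𝔅_k(V) ≠ ∅`, the Wilson
  action has a MINIMISER over `(6̄)(e)` — the set is closed (alpha-1's `isClosed_closedRegFibre`: the (0.4) descent is continuous on the closed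
  plaquette class because every intermediate average stays in the exp-mean-log guard, [Balaban1985Averaging] Prop. 2 PROVED in `BlockAveragingEMLProp2`),
  compact (`SU(2)^{bonds}`), the action continuous (`BalabanUVNodesN07DirectMethod.continuous_wilsonAction4`): `IsCompact.exists_isMinOn`;
* §3 what interiority buys: a closed-fibre minimiser lying in the OPEN class `𝔘_k(e)` minimises over print's space (6)(e) and is R2-critical
  (`T3Thm1CarrierNative.IsCritR2`), so Prop. 8 ∕ the halving step apply to it;
* §4 ★★ `existenceMinimalOrbit_of_interior` ∕ `existenceMinimalOrbit_of_interior_allL`: the existence half of `Prop7From14NativeAt`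
  (member level, and in route-R's uniform closure `∀ L > 1, ∀ B₃ > 4, ∃ a′₁ O₁, …`) ⇐ the ONE displayed ∀-sentence «for (7)-data `V` with a
  background (14), every minimiser of (5) over `(6̄)(O₁L³B₃ε₁)` lies in `𝔘_k(O₁L³B₃ε₁)`» — an a-priori (L^∞) estimate on closed-fibre minimisers,
  the species of Prop. 7 (ii) ∕ Prop. 8 ∕ Sect. F (the KKT form «(158) with a sign ⇒ (165)» named by the OWNER for p1∕w3-19200), NOT proved here.
* the CHEAPEST SUB-CASE in Lean (the interiority sentence HOLDS OUTRIGHT at the flat datum `V ≡ 1`, every radius) is the sibling module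
  `UnitScaleTiltProp7ClosedFibreMinimiserFlat`.
Twin at NODE 00's objects (d = 4, `T4Family`, `avOfRecord`): `BalabanUVNodesN07DirectMethod` §3, `…N07DirectMethodInduction`, `…N07AvoidanceAtFlatData`.

HONEST FRAMING.  Kernel theorems about the tree's own objects (compactness, continuity by name, the extreme-value theorem, bookkeeping of radii);
the direct method is NOT print's route to Prop. 7; NOTHING of [Balaban1985Variational] is asserted or proved; the interiority sentence stays
DISPLAYED (a hypothesis); no stub, no crux, no count moves; YM₃ on T³ is ladder rung R3 — not d = 4, not infinite volume, not a mass gap, not Clay.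

References: T. Bałaban, CMP **102** (1985) 277–309 [Balaban1985Variational] ((2)–(8) p.278, Thm 1 p.279, (14) p.280, Prop. 7, (141)–(143) p.299,
Prop. 8 p.304); CMP **98** (1985) 17–51 [Balaban1985Averaging] (Prop. 2 (52)–(54) p.26); CMP **99** (1985) 75–102 [Balaban1985RegularSpaces]
((1.1)–(1.2) p.76, (1.7)–(1.9) p.77); CMP **109** (1987) 249–301 [Balaban1987RG1] ((0.2) p.252, (0.4), (0.11) p.253).
-/

set_option autoImplicit false

noncomputable section

namespace Summit.QuantumFields.YangMills.Theorems.Prop7ClosedFibreMinimiser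

open Set Filter Topology
open scoped Matrix.Norms.L2Operator
open Literature.MathematicalPhysics.QuantumFieldTheory.Balaban1983to89
open Literature.MathematicalPhysics.QuantumFieldTheory.Balaban1983to89.T3ContinuumYM3Torus
open Literature.MathematicalPhysics.QuantumFieldTheory.Balaban1983to89.T3UnitLawDensityEML (ℰp)
open Literature.MathematicalPhysics.QuantumFieldTheory.Balaban1983to89.T3PrintedRegularMinimiser (RegPr DivSmall regFibrePr)
open Literature.MathematicalPhysics.QuantumFieldTheory.Balaban1983to89.T3PrintedMinimiserExistence (regFibrePr_mono regThreshold_mono regPr_mono)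
open Literature.MathematicalPhysics.QuantumFieldTheory.Balaban1983to89.T3RegularMinimiser (regThreshold regFibre)
open Literature.MathematicalPhysics.QuantumFieldTheory.Balaban1983to89.T3ConstrainedMinimiser (fibre)
open Literature.MathematicalPhysics.QuantumFieldTheory.Balaban1983to89.T3TiltDescent (descendTo)
open Literature.MathematicalPhysics.QuantumFieldTheory.Balaban1983to89.T3Thm1CarrierNative (IsCritR2 isCritR2_of_isMinOn Prop7From14NativeAt)
open Literature.MathematicalPhysics.QuantumFieldTheory.Balaban1983to89.B10Eq27TorusAxialLog (toUField unitsField)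
open Literature.MathematicalPhysics.QuantumFieldTheory.Balaban1983to89.B10Eq68TorusRegularity (covDivT)
open Literature.MathematicalPhysics.QuantumFieldTheory.Balaban1983to89.ExpMeanLog (deltaSU deltaSU_pos)
open Summit.QuantumFields.YangMills.BalabanUVNodes.N07DirectMethod (continuous_wilsonAction4 isCompact_of_isClosed_cfg)
open Summit.QuantumFields.YangMills.Theorems.MinimiserPin (isClosed_closedRegFibre regThreshold_eq)

/-! ## §1 Print's closed regular fibre `(6̄)(e)`: sandwich and non-emptiness from the background (14) -/

section Sandwich

variable (F : T3Family) {n K : ℕ} (h : n ≤ K)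

/-- **`(6)(e) ⊆ (6̄)(e)`**: print's (relatively open) regular fibre lies in its closed companion (strict `<` ⇒ `≤` in both clauses of (2)).
[cite: Balaban1985Variational, (2), (6) p.278] -/
theorem regFibrePr_subset_closedRegFibre (e : ℝ) (V : GaugeField (F.P n) 0 (Matrix.specialUnitaryGroup (Fin 2) ℂ)) :
    regFibrePr F n K h e V ⊆
      {U : GaugeField (F.P K) 0 (Matrix.specialUnitaryGroup (Fin 2) ℂ) | ∀ p : Plaq (F.P K) 0,
          GaugeGroup.dist1 (GaugeField.plaqHol U p) ≤ regThreshold F n K e} ∩ descendTo F ℰp n K h ⁻¹' {V} ∩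
        {U | ∀ b : PBond (F.P K) 0, ‖covDivT 1 (unitsField (toUField U)) b.dir b.src‖ ≤ e * ((F.L : ℝ)⁻¹) ^ (3 * (K - n))} :=
  fun _ hU => ⟨⟨fun p => (hU.1.2 p).le, hU.1.1⟩, fun b => (hU.2 b).le⟩

/-- **`(6̄)(e) ⊆ (6)(e′)` for `e < e′`**: the closed regular fibre lies in print's open regular fibre at every larger radius (both thresholds
`eL^{−2(K−n)}`, `eL^{−3(K−n)}` are strictly monotone in `e`). [cite: Balaban1985Variational, (2), (6) p.278] -/
theorem closedRegFibre_subset_regFibrePr {e e' : ℝ} (hee' : e < e') (V : GaugeField (F.P n) 0 (Matrix.specialUnitaryGroup (Fin 2) ℂ)) :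
    {U : GaugeField (F.P K) 0 (Matrix.specialUnitaryGroup (Fin 2) ℂ) | ∀ p : Plaq (F.P K) 0,
          GaugeGroup.dist1 (GaugeField.plaqHol U p) ≤ regThreshold F n K e} ∩ descendTo F ℰp n K h ⁻¹' {V} ∩
        {U | ∀ b : PBond (F.P K) 0, ‖covDivT 1 (unitsField (toUField U)) b.dir b.src‖ ≤ e * ((F.L : ℝ)⁻¹) ^ (3 * (K - n))} ⊆
      regFibrePr F n K h e' V := by
  rintro U ⟨⟨hplaq, hfib⟩, hdiv⟩
  have hLpos : (0 : ℝ) < F.L := by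
    have := F.hL.2
    exact_mod_cast (by omega : 0 < F.L)
  have hthr : regThreshold F n K e < regThreshold F n K e' := by
    rw [regThreshold_eq, regThreshold_eq]
    have : 0 < ((((F.P K).L : ℝ) ^ (K - n))⁻¹) ^ 2 := by
      have := (F.P K).L_pos
      positivity
    exact mul_lt_mul_of_pos_right hee' this
  have hLpow : 0 < ((F.L : ℝ)⁻¹) ^ (3 * (K - n)) := by positivity
  exact ⟨⟨hfib, fun p => (hplaq p).trans_lt hthr⟩, fun b => (hdiv b).trans_lt (mul_lt_mul_of_pos_right hee' hLpow)⟩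

/-- **THE BACKGROUND OF (14) LIES IN THE CLOSED FIBRE**: `U₀ ∈ 𝔘_k(e₀) ∩ 𝔅_k(V)` with `e₀ ≤ e` ⇒ `U₀ ∈ (6̄)(e) ∩ 𝔅_k(V)` — in print's regime
`e₀ = C₁B₃ε₁ = L³B₃ε₁ ≤ e = O(1)C₁B₃ε₁` the closed fibre over a (7)-datum is NON-EMPTY. [cite: Balaban1985Variational, (14) p.280, Prop. 7 p.299] -/
theorem background_mem_closedRegFibre {e₀ e : ℝ} (h₀ : e₀ ≤ e) {V : GaugeField (F.P n) 0 (Matrix.specialUnitaryGroup (Fin 2) ℂ)}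
    {U₀ : GaugeField (F.P K) 0 (Matrix.specialUnitaryGroup (Fin 2) ℂ)} (hreg : RegPr F n K e₀ U₀) (hfib : U₀ ∈ fibre F ℰp n K h V) :
    U₀ ∈ {U : GaugeField (F.P K) 0 (Matrix.specialUnitaryGroup (Fin 2) ℂ) | ∀ p : Plaq (F.P K) 0,
          GaugeGroup.dist1 (GaugeField.plaqHol U p) ≤ regThreshold F n K e} ∩ descendTo F ℰp n K h ⁻¹' {V} ∩
        {U | ∀ b : PBond (F.P K) 0, ‖covDivT 1 (unitsField (toUField U)) b.dir b.src‖ ≤ e * ((F.L : ℝ)⁻¹) ^ (3 * (K - n))} :=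
  regFibrePr_subset_closedRegFibre F h e V (regFibrePr_mono F h₀ V ⟨⟨hfib, hreg.1⟩, hreg.2⟩)

end Sandwich

/-! ## §2 ★ The direct method on `(6̄)(e)`: the Wilson action attains its minimum -/

section DirectMethod

variable (F : T3Family) {n K : ℕ} (h : n ≤ K)

/-- **AN ADMISSIBLE RADIUS EXISTS FOR EVERY BLOCK SIZE**: some `r > 0` with `2r` admissible in the sense of [Balaban1985Averaging] (53) at `d = 3`,
`N = 2` (`C₀(3)·2r ≤ ⅓`, `4r ≤ 2δ₂/(7L)²`) — e.g. `r = min (1/(6C₀(3))) (δ₂/(2(7L)²))`. [cite: Balaban1985Averaging, (53) p.26 (bookkeeping)] -/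
theorem exists_admissibleRadius :
    ∃ r : ℝ, 0 < r ∧ (143 * ((((3 + 4 : ℕ) : ℝ)) ^ 2 / 4) ^ 2) * (2 * r) ≤ 1 / 3 ∧
      2 * (2 * r) ≤ 2 * deltaSU (Fin 2) / (((3 + 4) * F.L : ℕ) : ℝ) ^ 2 := by
  set C : ℝ := 143 * ((((3 + 4 : ℕ) : ℝ)) ^ 2 / 4) ^ 2 with hC
  set M : ℝ := (((3 + 4) * F.L : ℕ) : ℝ) ^ 2 with hM
  have hCpos : 0 < C := by rw [hC]; positivity
  have hLpos : (0 : ℝ) < F.L := by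
    have := F.hL.2
    exact_mod_cast (by omega : 0 < F.L)
  have hMpos : 0 < M := by
    rw [hM]
    have : (0 : ℝ) < (((3 + 4) * F.L : ℕ) : ℝ) := by push_cast; positivity
    positivity
  have hδ := deltaSU_pos (n := Fin 2)
  refine ⟨min (1 / (6 * C)) (deltaSU (Fin 2) / (2 * M)), lt_min (by positivity) (by positivity), ?_, ?_⟩
  · have h1 : min (1 / (6 * C)) (deltaSU (Fin 2) / (2 * M)) ≤ 1 / (6 * C) := min_le_left _ _
    calc C * (2 * min (1 / (6 * C)) (deltaSU (Fin 2) / (2 * M))) ≤ C * (2 * (1 / (6 * C))) := by gcongr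
      _ = 1 / 3 := by field_simp; ring
  · have h2 : min (1 / (6 * C)) (deltaSU (Fin 2) / (2 * M)) ≤ deltaSU (Fin 2) / (2 * M) := min_le_right _ _
    calc 2 * (2 * min (1 / (6 * C)) (deltaSU (Fin 2) / (2 * M))) ≤ 2 * (2 * (deltaSU (Fin 2) / (2 * M))) := by gcongr
      _ = 2 * deltaSU (Fin 2) / M := by field_simp

/-- **`(6̄)(e)` IS COMPACT** for `e ≤ r`, `2r` admissible (closed by `AlphaInputsT3ACMinimiserPin.isClosed_closedRegFibre` in the compact
`SU(2)^{bonds}`). [cite: Balaban1985Variational, (2), (3), (6) p.278] -/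
theorem isCompact_closedRegFibre {r : ℝ} (hr : 0 < r)
    (hr3 : (143 * ((((3 + 4 : ℕ) : ℝ)) ^ 2 / 4) ^ 2) * (2 * r) ≤ 1 / 3)
    (hr2 : 2 * (2 * r) ≤ 2 * deltaSU (Fin 2) / (((3 + 4) * F.L : ℕ) : ℝ) ^ 2)
    {e : ℝ} (he : e ≤ r) (V : GaugeField (F.P n) 0 (Matrix.specialUnitaryGroup (Fin 2) ℂ)) :
    IsCompact ({U : GaugeField (F.P K) 0 (Matrix.specialUnitaryGroup (Fin 2) ℂ) | ∀ p : Plaq (F.P K) 0,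
          GaugeGroup.dist1 (GaugeField.plaqHol U p) ≤ regThreshold F n K e} ∩ descendTo F ℰp n K h ⁻¹' {V} ∩
        {U | ∀ b : PBond (F.P K) 0, ‖covDivT 1 (unitsField (toUField U)) b.dir b.src‖ ≤ e * ((F.L : ℝ)⁻¹) ^ (3 * (K - n))}) :=
  isCompact_of_isClosed_cfg (N := 2) (isClosed_closedRegFibre F n K h hr hr3 hr2 he V)

/-- ★ **THE DIRECT METHOD ON PRINT'S CLOSED REGULAR FIBRE.**  For `e ≤ r` with `2r` admissible as in [Balaban1985Averaging] (53) and every datum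
`V` on the `n`-th approximation's finest lattice whose closed fibre `(6̄)(e) ∩ 𝔅_k(V)` is non-empty, the Wilson action (5) has a MINIMISER `Ū`
over `(6̄)(e) ∩ 𝔅_k(V)` (compactness §2 + continuity of the action + the extreme-value theorem).  Print obtains a minimiser over the OPEN space
(6) otherwise (Props 4–7, (142)); what separates the two is §4's interiority sentence. [cite: Balaban1985Variational, (5)–(6) p.278, Prop. 7 p.299] -/
theorem exists_isMinOn_closedRegFibre {r : ℝ} (hr : 0 < r)
    (hr3 : (143 * ((((3 + 4 : ℕ) : ℝ)) ^ 2 / 4) ^ 2) * (2 * r) ≤ 1 / 3)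
    (hr2 : 2 * (2 * r) ≤ 2 * deltaSU (Fin 2) / (((3 + 4) * F.L : ℕ) : ℝ) ^ 2)
    {e : ℝ} (he : e ≤ r) (V : GaugeField (F.P n) 0 (Matrix.specialUnitaryGroup (Fin 2) ℂ))
    (hne : ({U : GaugeField (F.P K) 0 (Matrix.specialUnitaryGroup (Fin 2) ℂ) | ∀ p : Plaq (F.P K) 0,
          GaugeGroup.dist1 (GaugeField.plaqHol U p) ≤ regThreshold F n K e} ∩ descendTo F ℰp n K h ⁻¹' {V} ∩
        {U | ∀ b : PBond (F.P K) 0, ‖covDivT 1 (unitsField (toUField U)) b.dir b.src‖ ≤ e * ((F.L : ℝ)⁻¹) ^ (3 * (K - n))}).Nonempty) :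
    ∃ Ū ∈ {U : GaugeField (F.P K) 0 (Matrix.specialUnitaryGroup (Fin 2) ℂ) | ∀ p : Plaq (F.P K) 0,
          GaugeGroup.dist1 (GaugeField.plaqHol U p) ≤ regThreshold F n K e} ∩ descendTo F ℰp n K h ⁻¹' {V} ∩
        {U | ∀ b : PBond (F.P K) 0, ‖covDivT 1 (unitsField (toUField U)) b.dir b.src‖ ≤ e * ((F.L : ℝ)⁻¹) ^ (3 * (K - n))},
      IsMinOn (fun W : GaugeField (F.P K) 0 (Matrix.specialUnitaryGroup (Fin 2) ℂ) => wilsonAction4 W)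
        ({U : GaugeField (F.P K) 0 (Matrix.specialUnitaryGroup (Fin 2) ℂ) | ∀ p : Plaq (F.P K) 0,
            GaugeGroup.dist1 (GaugeField.plaqHol U p) ≤ regThreshold F n K e} ∩ descendTo F ℰp n K h ⁻¹' {V} ∩
          {U | ∀ b : PBond (F.P K) 0, ‖covDivT 1 (unitsField (toUField U)) b.dir b.src‖ ≤ e * ((F.L : ℝ)⁻¹) ^ (3 * (K - n))}) Ū :=
  (isCompact_closedRegFibre F h hr hr3 hr2 he V).exists_isMinOn hne (continuous_wilsonAction4 (N := 2)).continuousOn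

/-- **THE DIRECT METHOD IN PRINT'S REGIME**: a background `U₀ ∈ 𝔘_k(e₀) ∩ 𝔅_k(V)` with `e₀ ≤ e ≤ r` (`2r` admissible) makes the closed fibre
non-empty, so a minimiser of (5) over `(6̄)(e) ∩ 𝔅_k(V)` EXISTS, and its action is at most `A(U₀)` and at most `A(U)` for every competitor `U` of
the OPEN space (6)(e). [cite: Balaban1985Variational, (5)–(6) p.278, (14) p.280, Prop. 7 p.299] -/
theorem exists_isMinOn_closedRegFibre_of_background {r : ℝ} (hr : 0 < r)
    (hr3 : (143 * ((((3 + 4 : ℕ) : ℝ)) ^ 2 / 4) ^ 2) * (2 * r) ≤ 1 / 3)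
    (hr2 : 2 * (2 * r) ≤ 2 * deltaSU (Fin 2) / (((3 + 4) * F.L : ℕ) : ℝ) ^ 2)
    {e₀ e : ℝ} (h₀ : e₀ ≤ e) (he : e ≤ r) {V : GaugeField (F.P n) 0 (Matrix.specialUnitaryGroup (Fin 2) ℂ)}
    {U₀ : GaugeField (F.P K) 0 (Matrix.specialUnitaryGroup (Fin 2) ℂ)} (hreg : RegPr F n K e₀ U₀) (hfib : U₀ ∈ fibre F ℰp n K h V) :
    ∃ Ū ∈ {U : GaugeField (F.P K) 0 (Matrix.specialUnitaryGroup (Fin 2) ℂ) | ∀ p : Plaq (F.P K) 0,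
          GaugeGroup.dist1 (GaugeField.plaqHol U p) ≤ regThreshold F n K e} ∩ descendTo F ℰp n K h ⁻¹' {V} ∩
        {U | ∀ b : PBond (F.P K) 0, ‖covDivT 1 (unitsField (toUField U)) b.dir b.src‖ ≤ e * ((F.L : ℝ)⁻¹) ^ (3 * (K - n))},
      IsMinOn (fun W : GaugeField (F.P K) 0 (Matrix.specialUnitaryGroup (Fin 2) ℂ) => wilsonAction4 W)
        ({U : GaugeField (F.P K) 0 (Matrix.specialUnitaryGroup (Fin 2) ℂ) | ∀ p : Plaq (F.P K) 0,
            GaugeGroup.dist1 (GaugeField.plaqHol U p) ≤ regThreshold F n K e} ∩ descendTo F ℰp n K h ⁻¹' {V} ∩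
          {U | ∀ b : PBond (F.P K) 0, ‖covDivT 1 (unitsField (toUField U)) b.dir b.src‖ ≤ e * ((F.L : ℝ)⁻¹) ^ (3 * (K - n))}) Ū ∧
      wilsonAction4 Ū ≤ wilsonAction4 U₀ ∧
      ∀ U ∈ regFibrePr F n K h e V, wilsonAction4 Ū ≤ wilsonAction4 U := by
  obtain ⟨Ū, hŪ, hmin⟩ := exists_isMinOn_closedRegFibre F h hr hr3 hr2 he V ⟨U₀, background_mem_closedRegFibre F h h₀ hreg hfib⟩
  exact ⟨Ū, hŪ, hmin, hmin (background_mem_closedRegFibre F h h₀ hreg hfib),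
    fun U hU => hmin (regFibrePr_subset_closedRegFibre F h e V hU)⟩

end DirectMethod

/-! ## §3 What interiority buys: an interior closed-fibre minimiser minimises over print's open space (6) and is R2-critical -/

section Interior

variable (F : T3Family) {n K : ℕ} (h : n ≤ K)

/-- **AN INTERIOR CLOSED-FIBRE MINIMISER IS A MINIMISER OVER PRINT'S SPACE (6)(e)**: if `Ū` minimises (5) over `(6̄)(e) ∩ 𝔅_k(V)` and lies in the
open class `𝔘_k(e)` (both STRICT clauses of (2)), then `Ū ∈ (6)(e)` and `Ū` minimises over `(6)(e) ⊆ (6̄)(e)`. [cite: Balaban1985Variational, (5)–(6) p.278, Prop. 7 p.299] -/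
theorem isMinOn_regFibrePr_of_interior {e : ℝ} {V : GaugeField (F.P n) 0 (Matrix.specialUnitaryGroup (Fin 2) ℂ)}
    {Ū : GaugeField (F.P K) 0 (Matrix.specialUnitaryGroup (Fin 2) ℂ)}
    (hmin : IsMinOn (fun W : GaugeField (F.P K) 0 (Matrix.specialUnitaryGroup (Fin 2) ℂ) => wilsonAction4 W)
        ({U : GaugeField (F.P K) 0 (Matrix.specialUnitaryGroup (Fin 2) ℂ) | ∀ p : Plaq (F.P K) 0,
            GaugeGroup.dist1 (GaugeField.plaqHol U p) ≤ regThreshold F n K e} ∩ descendTo F ℰp n K h ⁻¹' {V} ∩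
          {U | ∀ b : PBond (F.P K) 0, ‖covDivT 1 (unitsField (toUField U)) b.dir b.src‖ ≤ e * ((F.L : ℝ)⁻¹) ^ (3 * (K - n))}) Ū)
    (hfib : Ū ∈ fibre F ℰp n K h V) (hint : RegPr F n K e Ū) :
    Ū ∈ regFibrePr F n K h e V ∧
      IsMinOn (fun W : GaugeField (F.P K) 0 (Matrix.specialUnitaryGroup (Fin 2) ℂ) => wilsonAction4 W) (regFibrePr F n K h e V) Ū :=
  ⟨⟨⟨hfib, hint.1⟩, hint.2⟩, hmin.on_subset (regFibrePr_subset_closedRegFibre F h e V)⟩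

/-- … and is therefore CRITICAL in reading R2 (`T3Thm1CarrierNative.IsCritR2`: a minimiser over (6)(e) at SOME radius `e > 0`), so that print's
Prop. 8 («critical configurations in (6) with (7)-data lie in (8)») and the halving step read it. [cite: Balaban1985Variational, Prop. 8 p.304] -/
theorem isCritR2_of_interior {e : ℝ} (he : 0 < e) {V : GaugeField (F.P n) 0 (Matrix.specialUnitaryGroup (Fin 2) ℂ)}
    {Ū : GaugeField (F.P K) 0 (Matrix.specialUnitaryGroup (Fin 2) ℂ)}
    (hmin : IsMinOn (fun W : GaugeField (F.P K) 0 (Matrix.specialUnitaryGroup (Fin 2) ℂ) => wilsonAction4 W)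
        ({U : GaugeField (F.P K) 0 (Matrix.specialUnitaryGroup (Fin 2) ℂ) | ∀ p : Plaq (F.P K) 0,
            GaugeGroup.dist1 (GaugeField.plaqHol U p) ≤ regThreshold F n K e} ∩ descendTo F ℰp n K h ⁻¹' {V} ∩
          {U | ∀ b : PBond (F.P K) 0, ‖covDivT 1 (unitsField (toUField U)) b.dir b.src‖ ≤ e * ((F.L : ℝ)⁻¹) ^ (3 * (K - n))}) Ū)
    (hfib : Ū ∈ fibre F ℰp n K h V) (hint : RegPr F n K e Ū) : IsCritR2 F n K h V Ū :=
  isCritR2_of_isMinOn he (isMinOn_regFibrePr_of_interior F h hmin hfib hint).1 (isMinOn_regFibrePr_of_interior F h hmin hfib hint).2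

end Interior

/-! ## §4 ★★ The existence half of `Prop7From14NativeAt` re-pointed onto ONE interiority sentence -/

section Existence

/-- ★★ **THE EXISTENCE CLAUSE OF PROP. 7 FROM A BACKGROUND (14), MEMBER LEVEL, ⇐ «CLOSED-FIBRE MINIMISERS ARE INTERIOR».**  Fix the block size
`L`, constants `B₃ > 0`, `O₁ ≥ 1`, `a′₁ > 0` with `2·O₁L³B₃a′₁` admissible as in [Balaban1985Averaging] (53).  ASSUME the displayed ∀-sentence
`hInt`: for every member with `F.L = L`, `n < K`, `0 < ε₁ ≤ a′₁`, every (7)-datum `V` (`|V(∂p) − 1| < ε₁`) carrying a background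
`U₀ ∈ 𝔘_k(L³B₃ε₁) ∩ 𝔅_k(V)` (print's (14) with `C₁ = L³`), every minimiser of the Wilson action over the closed fibre `(6̄)(e) ∩ 𝔅_k(V)`,
`e = O₁L³B₃ε₁`, lies in the open class `𝔘_k(e)`.  THEN the existence half of `T3Thm1CarrierNative.Prop7From14NativeAt L · a′₁ O₁ B₃` holds:
`∃ U ∈ regFibrePr (O₁L³B₃ε₁) V` minimising (5) over that space (§2 supplies the closed-fibre minimiser, `hInt` puts it inside, §3 concludes).
[cite: Balaban1985Variational, Prop. 7 p.299, (14) p.280, (141)–(143) p.299] -/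
theorem existenceMinimalOrbit_of_interior (F : T3Family) {B₃ O₁ a₁' : ℝ} (hB₃ : 0 < B₃) (hO₁ : 1 ≤ O₁)
    (hA3 : (143 * ((((3 + 4 : ℕ) : ℝ)) ^ 2 / 4) ^ 2) * (2 * (O₁ * (F.L : ℝ) ^ 3 * B₃ * a₁')) ≤ 1 / 3)
    (hA2 : 2 * (2 * (O₁ * (F.L : ℝ) ^ 3 * B₃ * a₁')) ≤ 2 * deltaSU (Fin 2) / (((3 + 4) * F.L : ℕ) : ℝ) ^ 2)
    (hInt : ∀ (n K : ℕ) (hnK : n < K) (ε₁ : ℝ), 0 < ε₁ → ε₁ ≤ a₁' →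
      ∀ V : GaugeField (F.P n) 0 (Matrix.specialUnitaryGroup (Fin 2) ℂ), PlaqSmall ε₁ V →
        ∀ U₀ : GaugeField (F.P K) 0 (Matrix.specialUnitaryGroup (Fin 2) ℂ), RegPr F n K ((F.L : ℝ) ^ 3 * B₃ * ε₁) U₀ →
          U₀ ∈ fibre F ℰp n K hnK.le V →
          ∀ Ū : GaugeField (F.P K) 0 (Matrix.specialUnitaryGroup (Fin 2) ℂ),
            Ū ∈ {U : GaugeField (F.P K) 0 (Matrix.specialUnitaryGroup (Fin 2) ℂ) | ∀ p : Plaq (F.P K) 0,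
                  GaugeGroup.dist1 (GaugeField.plaqHol U p) ≤ regThreshold F n K (O₁ * (F.L : ℝ) ^ 3 * B₃ * ε₁)} ∩
                descendTo F ℰp n K hnK.le ⁻¹' {V} ∩
                {U | ∀ b : PBond (F.P K) 0, ‖covDivT 1 (unitsField (toUField U)) b.dir b.src‖ ≤
                  (O₁ * (F.L : ℝ) ^ 3 * B₃ * ε₁) * ((F.L : ℝ)⁻¹) ^ (3 * (K - n))} →
            IsMinOn (fun W : GaugeField (F.P K) 0 (Matrix.specialUnitaryGroup (Fin 2) ℂ) => wilsonAction4 W)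
              ({U : GaugeField (F.P K) 0 (Matrix.specialUnitaryGroup (Fin 2) ℂ) | ∀ p : Plaq (F.P K) 0,
                  GaugeGroup.dist1 (GaugeField.plaqHol U p) ≤ regThreshold F n K (O₁ * (F.L : ℝ) ^ 3 * B₃ * ε₁)} ∩
                descendTo F ℰp n K hnK.le ⁻¹' {V} ∩
                {U | ∀ b : PBond (F.P K) 0, ‖covDivT 1 (unitsField (toUField U)) b.dir b.src‖ ≤
                  (O₁ * (F.L : ℝ) ^ 3 * B₃ * ε₁) * ((F.L : ℝ)⁻¹) ^ (3 * (K - n))}) Ū →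
            RegPr F n K (O₁ * (F.L : ℝ) ^ 3 * B₃ * ε₁) Ū)
    (n K : ℕ) (hnK : n < K) (ε₁ : ℝ) (hε₁ : 0 < ε₁)
    (V : GaugeField (F.P n) 0 (Matrix.specialUnitaryGroup (Fin 2) ℂ)) (hV : PlaqSmall ε₁ V)
    (U₀ : GaugeField (F.P K) 0 (Matrix.specialUnitaryGroup (Fin 2) ℂ)) (hreg : RegPr F n K ((F.L : ℝ) ^ 3 * B₃ * ε₁) U₀)
    (hfib : U₀ ∈ fibre F ℰp n K hnK.le V) (hε₁a : ε₁ ≤ a₁') :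
    ∃ U ∈ regFibrePr F n K hnK.le (O₁ * (F.L : ℝ) ^ 3 * B₃ * ε₁) V,
      IsMinOn (fun W : GaugeField (F.P K) 0 (Matrix.specialUnitaryGroup (Fin 2) ℂ) => wilsonAction4 W)
        (regFibrePr F n K hnK.le (O₁ * (F.L : ℝ) ^ 3 * B₃ * ε₁) V) U := by
  have hLpos : (0 : ℝ) < F.L := by
    have := F.hL.2
    exact_mod_cast (by omega : 0 < F.L)
  have hL3B : 0 < (F.L : ℝ) ^ 3 * B₃ := by positivity
  -- the radius `e = O₁L³B₃ε₁` and the admissible bound `r = O₁L³B₃a′₁`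
  have hr : 0 < O₁ * (F.L : ℝ) ^ 3 * B₃ * a₁' := by
    have : 0 < a₁' := hε₁.trans_le hε₁a
    have hO : 0 < O₁ := one_pos.trans_le hO₁
    positivity
  have he : O₁ * (F.L : ℝ) ^ 3 * B₃ * ε₁ ≤ O₁ * (F.L : ℝ) ^ 3 * B₃ * a₁' :=
    mul_le_mul_of_nonneg_left hε₁a (by have hO : 0 < O₁ := one_pos.trans_le hO₁; positivity)
  have h₀ : (F.L : ℝ) ^ 3 * B₃ * ε₁ ≤ O₁ * (F.L : ℝ) ^ 3 * B₃ * ε₁ := by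
    have : (F.L : ℝ) ^ 3 * B₃ * ε₁ = 1 * ((F.L : ℝ) ^ 3 * B₃ * ε₁) := (one_mul _).symm
    rw [this, show O₁ * (F.L : ℝ) ^ 3 * B₃ * ε₁ = O₁ * ((F.L : ℝ) ^ 3 * B₃ * ε₁) by ring]
    exact mul_le_mul_of_nonneg_right hO₁ (by positivity)
  obtain ⟨Ū, hŪ, hmin, -, -⟩ := exists_isMinOn_closedRegFibre_of_background F hnK.le hr hA3 hA2 h₀ he hreg hfib
  have hint : RegPr F n K (O₁ * (F.L : ℝ) ^ 3 * B₃ * ε₁) Ū := hInt n K hnK ε₁ hε₁ hε₁a V hV U₀ hreg hfib Ū hŪ hmin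
  exact ⟨Ū, isMinOn_regFibrePr_of_interior F hnK.le hmin hŪ.1.2 hint⟩

/-- ★★ **THE EXISTENCE HALF OF V3 IN ROUTE-R's UNIFORM CLOSURE ⇐ INTERIORITY, FOR ALL `L`.**  If for every block size `L > 1` and every `B₃ > 4`
there are `a′₁ > 0`, `O₁ ≥ 1` such that closed-fibre minimisers over (7)-data with a (14)-background are interior (the sentence `hInt` of
`existenceMinimalOrbit_of_interior`, quantified over the members with `F.L = L`), then the existence half of
`T3Thm1CarrierNative.Prop7From14NativeAt` holds in the uniform shape of OWNER RULING g24-№2 §(c) (`stub_existenceMinimalOrbit`): `∀ L > 1, ∀ B₃ > 4,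
∃ a″₁ O₁, 0 < a″₁ ∧ 1 ≤ O₁ ∧ ∀ F, F.L = L → … → ε₁ ≤ a″₁ → ∃ U ∈ regFibrePr (O₁L³B₃ε₁) V` minimising (5) over it — with `a″₁ ≤ a′₁` shrunk
only to make `2·O₁L³B₃a″₁` admissible (§2). [cite: Balaban1985Variational, Prop. 7 p.299, (14) p.280] -/
theorem existenceMinimalOrbit_of_interior_allL
    (hInt : ∀ L : ℕ, 1 < L → ∀ B₃ : ℝ, 4 < B₃ → ∃ a₁' O₁ : ℝ, 0 < a₁' ∧ 1 ≤ O₁ ∧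
      ∀ F : T3Family, F.L = L → ∀ (n K : ℕ) (hnK : n < K) (ε₁ : ℝ), 0 < ε₁ → ε₁ ≤ a₁' →
        ∀ V : GaugeField (F.P n) 0 (Matrix.specialUnitaryGroup (Fin 2) ℂ), PlaqSmall ε₁ V →
          ∀ U₀ : GaugeField (F.P K) 0 (Matrix.specialUnitaryGroup (Fin 2) ℂ), RegPr F n K ((L : ℝ) ^ 3 * B₃ * ε₁) U₀ →
            U₀ ∈ fibre F ℰp n K hnK.le V →
            ∀ Ū : GaugeField (F.P K) 0 (Matrix.specialUnitaryGroup (Fin 2) ℂ),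
              Ū ∈ {U : GaugeField (F.P K) 0 (Matrix.specialUnitaryGroup (Fin 2) ℂ) | ∀ p : Plaq (F.P K) 0,
                    GaugeGroup.dist1 (GaugeField.plaqHol U p) ≤ regThreshold F n K (O₁ * (L : ℝ) ^ 3 * B₃ * ε₁)} ∩
                  descendTo F ℰp n K hnK.le ⁻¹' {V} ∩
                  {U | ∀ b : PBond (F.P K) 0, ‖covDivT 1 (unitsField (toUField U)) b.dir b.src‖ ≤
                    (O₁ * (L : ℝ) ^ 3 * B₃ * ε₁) * ((F.L : ℝ)⁻¹) ^ (3 * (K - n))} →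
              IsMinOn (fun W : GaugeField (F.P K) 0 (Matrix.specialUnitaryGroup (Fin 2) ℂ) => wilsonAction4 W)
                ({U : GaugeField (F.P K) 0 (Matrix.specialUnitaryGroup (Fin 2) ℂ) | ∀ p : Plaq (F.P K) 0,
                    GaugeGroup.dist1 (GaugeField.plaqHol U p) ≤ regThreshold F n K (O₁ * (L : ℝ) ^ 3 * B₃ * ε₁)} ∩
                  descendTo F ℰp n K hnK.le ⁻¹' {V} ∩
                  {U | ∀ b : PBond (F.P K) 0, ‖covDivT 1 (unitsField (toUField U)) b.dir b.src‖ ≤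
                    (O₁ * (L : ℝ) ^ 3 * B₃ * ε₁) * ((F.L : ℝ)⁻¹) ^ (3 * (K - n))}) Ū →
              RegPr F n K (O₁ * (L : ℝ) ^ 3 * B₃ * ε₁) Ū) :
    ∀ L : ℕ, 1 < L → ∀ B₃ : ℝ, 4 < B₃ → ∃ a₁' O₁ : ℝ, 0 < a₁' ∧ 1 ≤ O₁ ∧
      ∀ F : T3Family, F.L = L → ∀ (n K : ℕ) (hnK : n < K) (ε₁ : ℝ), 0 < ε₁ →
        ∀ V : GaugeField (F.P n) 0 (Matrix.specialUnitaryGroup (Fin 2) ℂ), PlaqSmall ε₁ V →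
          ∀ U₀ : GaugeField (F.P K) 0 (Matrix.specialUnitaryGroup (Fin 2) ℂ), RegPr F n K ((L : ℝ) ^ 3 * B₃ * ε₁) U₀ →
            U₀ ∈ fibre F ℰp n K hnK.le V → ε₁ ≤ a₁' →
              ∃ U ∈ regFibrePr F n K hnK.le (O₁ * (L : ℝ) ^ 3 * B₃ * ε₁) V,
                IsMinOn (fun W : GaugeField (F.P K) 0 (Matrix.specialUnitaryGroup (Fin 2) ℂ) => wilsonAction4 W)
                  (regFibrePr F n K hnK.le (O₁ * (L : ℝ) ^ 3 * B₃ * ε₁) V) U := by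
  intro L hL B₃ hB₃
  obtain ⟨a₁', O₁, ha₁', hO₁, hI⟩ := hInt L hL B₃ hB₃
  -- an admissible radius `r(L)` and the shrunk constant `a″₁ = min a′₁ (r / (O₁L³B₃))`
  set C : ℝ := 143 * ((((3 + 4 : ℕ) : ℝ)) ^ 2 / 4) ^ 2 with hC
  set M : ℝ := (((3 + 4) * L : ℕ) : ℝ) ^ 2 with hM
  have hCpos : 0 < C := by rw [hC]; positivity
  have hLpos : (0 : ℝ) < L := by exact_mod_cast (by omega : 0 < L)
  have hMpos : 0 < M := by
    rw [hM]
    have : (0 : ℝ) < (((3 + 4) * L : ℕ) : ℝ) := by push_cast; positivity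
    positivity
  have hδ := deltaSU_pos (n := Fin 2)
  set r : ℝ := min (1 / (6 * C)) (deltaSU (Fin 2) / (2 * M)) with hr_def
  have hr : 0 < r := lt_min (by positivity) (by positivity)
  have hr3 : C * (2 * r) ≤ 1 / 3 := by
    calc C * (2 * r) ≤ C * (2 * (1 / (6 * C))) := by gcongr; exact min_le_left _ _
      _ = 1 / 3 := by field_simp; ring
  have hr2 : 2 * (2 * r) ≤ 2 * deltaSU (Fin 2) / M := by
    calc 2 * (2 * r) ≤ 2 * (2 * (deltaSU (Fin 2) / (2 * M))) := by gcongr; exact min_le_right _ _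
      _ = 2 * deltaSU (Fin 2) / M := by field_simp
  have hB₃pos : 0 < B₃ := by linarith
  have hO₁pos : 0 < O₁ := one_pos.trans_le hO₁
  have hD : 0 < O₁ * (L : ℝ) ^ 3 * B₃ := by positivity
  set a₁'' : ℝ := min a₁' (r / (O₁ * (L : ℝ) ^ 3 * B₃)) with ha''
  have ha₁'' : 0 < a₁'' := lt_min ha₁' (div_pos hr hD)
  have ha''le : a₁'' ≤ a₁' := min_le_left _ _
  have hwin : O₁ * (L : ℝ) ^ 3 * B₃ * a₁'' ≤ r := by
    have : a₁'' ≤ r / (O₁ * (L : ℝ) ^ 3 * B₃) := min_le_right _ _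
    rwa [le_div_iff₀ hD, mul_comm] at this
  refine ⟨a₁'', O₁, ha₁'', hO₁, fun F hF n K hnK ε₁ hε₁ V hV U₀ hreg hfib hε₁a => ?_⟩
  -- read everything at the member: `L = F.L`
  subst hF
  have hA3 : C * (2 * (O₁ * (F.L : ℝ) ^ 3 * B₃ * a₁'')) ≤ 1 / 3 := by
    calc C * (2 * (O₁ * (F.L : ℝ) ^ 3 * B₃ * a₁'')) ≤ C * (2 * r) := by gcongr
      _ ≤ 1 / 3 := hr3
  have hA2 : 2 * (2 * (O₁ * (F.L : ℝ) ^ 3 * B₃ * a₁'')) ≤ 2 * deltaSU (Fin 2) / (((3 + 4) * F.L : ℕ) : ℝ) ^ 2 := by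
    calc 2 * (2 * (O₁ * (F.L : ℝ) ^ 3 * B₃ * a₁'')) ≤ 2 * (2 * r) := by gcongr
      _ ≤ 2 * deltaSU (Fin 2) / M := hr2
  exact existenceMinimalOrbit_of_interior F hB₃pos hO₁ hA3 hA2
    (fun n K hnK ε₁ hε₁ hε₁a V hV U₀ hreg hfib Ū hŪ hmin =>
      hI F rfl n K hnK ε₁ hε₁ (hε₁a.trans ha''le) V hV U₀ hreg hfib Ū hŪ hmin)
    n K hnK ε₁ hε₁ V hV U₀ hreg hfib hε₁a

end Existence


end Summit.QuantumFields.YangMills.Theorems.Prop7ClosedFibreMinimiser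

end
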